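import Mathlib
import HarnessLib
import Summits.HubbardSuperconductivity.HubbardSuperconductivity.Theorems.KLProgrammeRungCutoffAlgebra

/-!
# Route `KLProgramme` — crux K3, ENGINE child (`KLRegimeEngineV14`, stmt-HubbardSuperconductivity-19918), stub `stub_engine_step_values`
# (E2-v9) (m): the SHARP same-slice `ds/s`-mass of the carrier's slice weight, `∫_{s>0} w_n(s)² ds/s ≤ log 16`
# (cell gate-hubbard-kl, seat hubbard-kl-k3c2-p2 «thermal-bar induction n ≤ nScales β + 1»)

Companion of `…RungCutoffAlgebra` (`klrc_sameSlice_mass_le`: the crude `log 64` from `w ≤ 1` on the support `(Λ²/4, 16Λ²)`).  Here the three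
pieces of the support are used: on `[Λ²/4, Λ²]` the weight is `a = χ₂(s/Λ²)`, on `[Λ², 4Λ²]` it is `1`, on `[4Λ², 16Λ²]` it is `1 − χ₂(s/(4Λ)²)`;
the `ds/s`-invariant substitution `s ↦ s/16` carries the third piece onto the first, where `a² + (1 − a)² ≤ 1`, so the total is
`≤ log 4 + log 4 = log 16 < 14/5` — the sharp scale-free constant that the radial mass lemmas (`…RadialMassSharp`, `…RadialMassPlanar`) multiply
by `B_W/2` (same-slice sign-blind rung mass `≤ (A₀π√2/d)·log 16/(4π) + thermal ≈ 0.22·A₀·B_J` per unit `(2π)²`).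

* `klrc_intervalIntegrable_div`, `klrc_sq_add_one_sub_sq_le`, **`klrc_sameSlice_mass_le_sharp`**, `klrc_log_sixteen_le`,
  `klrc_step_sameSlice_mass_le_sharp` (the carrier's spelling at scale `n ≥ 1`).

Pure real analysis of the tree's cutoff; nothing about the effective action is asserted.
-/

noncomputable section

namespace Summit.HubbardSuperconductivity.HubbardSuperconductivity.Theorems.KLRegimeSplit

set_option linter.dupNamespace false -- summit = problem name (single-conjunct summit), D-0017

open Real Set MeasureTheory intervalIntegral Literature.MathematicalPhysics.QuantumLattice Literature.Probability.LatticeModels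
open Summit.HubbardSuperconductivity.HubbardSuperconductivity.Theorems.KLProgrammeLegKernels

/-! ## The SHARP same-slice mass `∫ w² ds/s ≤ log 16`

On `[Λ²/4, Λ²]` the slice weight is `a = χ₂(s/Λ²)`, on `[Λ², 4Λ²]` it is `1`, on `[4Λ², 16Λ²]` it is `1 − χ₂(s/(4Λ)²)`; the `ds/s`-substitution
`s ↦ s/16` carries the third piece onto the first, where `a² + (1 − a)² ≤ 1`: total `≤ log 4 + log 4 = log 16` (vs the crude `log 64`). -/

/-- Interval integrability of `s ↦ g(s)/s` on `[u, v] ⊂ (0, ∞)` for continuous `g`. -/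
theorem klrc_intervalIntegrable_div {g : ℝ → ℝ} (hg : Continuous g) {u v : ℝ} (hu : 0 < u) (huv : u ≤ v) :
    IntervalIntegrable (fun s => g s / s) volume u v :=
  (hg.continuousOn.div continuousOn_id fun _ hs => (lt_of_lt_of_le hu hs.1).ne').intervalIntegrable_of_Icc huv

/-- `u² + (1 − u)² ≤ 1` for `u ∈ [0, 1]`. -/
theorem klrc_sq_add_one_sub_sq_le {u : ℝ} (h0 : 0 ≤ u) (h1 : u ≤ 1) : u ^ 2 + (1 - u) ^ 2 ≤ 1 := by nlinarith

/-- **Same-slice mass, sharp**: `∫_{s>0} (χ₂(s/Λ²) − χ₂(s/(4Λ)²))² ds/s ≤ log 16`. -/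
theorem klrc_sameSlice_mass_le_sharp {Λ : ℝ} (hΛ : 0 < Λ) :
    ∫ s in Ioi 0, (salmhoferCutoff (s / Λ ^ 2) - salmhoferCutoff (s / (4 * Λ) ^ 2)) ^ 2 / s ≤ Real.log 16 := by
  have hΛ2 : 0 < Λ ^ 2 := by positivity
  have hu : 0 < Λ ^ 2 / 4 := by positivity
  -- the two weights and the integrand
  set a : ℝ → ℝ := fun s => salmhoferCutoff (s / Λ ^ 2) with ha
  set b : ℝ → ℝ := fun s => salmhoferCutoff (s / (4 * Λ) ^ 2) with hb
  have hca : Continuous a := klrc_continuous_chi.comp (continuous_id.div_const _)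
  have hcb : Continuous b := klrc_continuous_chi.comp (continuous_id.div_const _)
  have hcw : Continuous fun s => (a s - b s) ^ 2 := (hca.sub hcb).pow 2
  have hii : ∀ u v : ℝ, 0 < u → u ≤ v → IntervalIntegrable (fun s => (a s - b s) ^ 2 / s) volume u v :=
    fun u v hu huv => klrc_intervalIntegrable_div hcw hu huv
  -- from the half-line to `[Λ²/4, 16Λ²]`
  have hzero : ∀ s, s ∉ Ioo (Λ ^ 2 / 4) (16 * Λ ^ 2) → (a s - b s) ^ 2 = 0 := by
    intro s hs
    rw [mem_Ioo, not_and_or, not_lt, not_lt] at hs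
    rcases hs with hs | hs
    · have h := klwt_zero_of_le hΛ s (by nlinarith)
      have h' : salmhoferCutoff (s / Λ ^ 2) - salmhoferCutoff (s / (4 * Λ) ^ 2) = 0 := by exact_mod_cast h
      simp only [ha, hb, h', zero_pow two_ne_zero]
    · have h := klwt_zero_of_ge hΛ s (by nlinarith)
      have h' : salmhoferCutoff (s / Λ ^ 2) - salmhoferCutoff (s / (4 * Λ) ^ 2) = 0 := by exact_mod_cast h
      simp only [ha, hb, h', zero_pow two_ne_zero]
  have hI : ∫ s in Ioi 0, (salmhoferCutoff (s / Λ ^ 2) - salmhoferCutoff (s / (4 * Λ) ^ 2)) ^ 2 / s =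
      ∫ s in (Λ ^ 2 / 4)..(16 * Λ ^ 2), (a s - b s) ^ 2 / s :=
    klrc_setIntegral_Ioi_div_eq (G := fun s => (a s - b s) ^ 2) hu (by nlinarith) hzero
  rw [hI, ← intervalIntegral.integral_add_adjacent_intervals (hii _ _ hu (by nlinarith : Λ ^ 2 / 4 ≤ Λ ^ 2))
      (hii _ _ hΛ2 (by nlinarith : Λ ^ 2 ≤ 16 * Λ ^ 2)),
    ← intervalIntegral.integral_add_adjacent_intervals (hii _ _ hΛ2 (by nlinarith : Λ ^ 2 ≤ 4 * Λ ^ 2))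
      (hii _ _ (by positivity : (0:ℝ) < 4 * Λ ^ 2) (by nlinarith : 4 * Λ ^ 2 ≤ 16 * Λ ^ 2))]
  -- values of the weights on the three pieces
  have hb0 : ∀ s, s ≤ 4 * Λ ^ 2 → b s = 0 := fun s hs => by
    simp only [hb]; exact salmhoferCutoff_of_le (by rw [div_le_iff₀ (by positivity)]; nlinarith)
  have ha1 : ∀ s, Λ ^ 2 ≤ s → a s = 1 := fun s hs => by
    simp only [ha]; exact salmhoferCutoff_of_ge (by rwa [le_div_iff₀ hΛ2, one_mul])
  have hba : ∀ s, b s = a (s / 16) := fun s => by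
    simp only [ha, hb]; congr 1; field_simp; ring
  -- piece 2: `= log 4`
  have h2 : ∫ s in (Λ ^ 2)..(4 * Λ ^ 2), (a s - b s) ^ 2 / s = Real.log 4 := by
    have heq : EqOn (fun s => (a s - b s) ^ 2 / s) (fun s => s⁻¹) (uIcc (Λ ^ 2) (4 * Λ ^ 2)) := by
      intro s hs
      rw [uIcc_of_le (by nlinarith)] at hs
      simp only
      rw [ha1 s hs.1, hb0 s hs.2, sub_zero, one_pow, one_div]
    rw [intervalIntegral.integral_congr heq, integral_inv (Set.notMem_uIcc_of_lt hΛ2 (by positivity)),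
      show 4 * Λ ^ 2 / Λ ^ 2 = 4 by field_simp]
  -- piece 1: `= ∫ a²/s`
  have h1 : ∫ s in (Λ ^ 2 / 4)..(Λ ^ 2), (a s - b s) ^ 2 / s = ∫ s in (Λ ^ 2 / 4)..(Λ ^ 2), a s ^ 2 / s := by
    refine intervalIntegral.integral_congr fun s hs => ?_
    rw [uIcc_of_le (by nlinarith)] at hs
    show (a s - b s) ^ 2 / s = a s ^ 2 / s
    rw [hb0 s (by nlinarith [hs.2]), sub_zero]
  -- piece 3: `= ∫ (1 − a)²/s` over the first piece (substitution `s ↦ s/16`)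
  have h3 : ∫ s in (4 * Λ ^ 2)..(16 * Λ ^ 2), (a s - b s) ^ 2 / s = ∫ s in (Λ ^ 2 / 4)..(Λ ^ 2), (1 - a s) ^ 2 / s := by
    have heq : EqOn (fun s => (a s - b s) ^ 2 / s) (fun s => (fun t => (1 - a t) ^ 2 / t) (s / 16) / 16)
        (uIcc (4 * Λ ^ 2) (16 * Λ ^ 2)) := by
      intro s hs
      rw [uIcc_of_le (by nlinarith)] at hs
      have hs0 : 0 < s := lt_of_lt_of_le (by positivity) hs.1
      simp only
      rw [ha1 s (by nlinarith [hs.1]), hba s]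
      field_simp
    rw [intervalIntegral.integral_congr heq, intervalIntegral.integral_div,
      intervalIntegral.integral_comp_div (f := fun t => (1 - a t) ^ 2 / t) (by norm_num : (16:ℝ) ≠ 0),
      show 4 * Λ ^ 2 / 16 = Λ ^ 2 / 4 by ring, show 16 * Λ ^ 2 / 16 = Λ ^ 2 by ring, smul_eq_mul]
    ring
  -- pieces 1 + 3 `≤ log 4`
  have h13 : (∫ s in (Λ ^ 2 / 4)..(Λ ^ 2), a s ^ 2 / s) + ∫ s in (Λ ^ 2 / 4)..(Λ ^ 2), (1 - a s) ^ 2 / s ≤ Real.log 4 := by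
    have hca2 : Continuous fun s => a s ^ 2 := hca.pow 2
    have hcb2 : Continuous fun s => (1 - a s) ^ 2 := (continuous_const.sub hca).pow 2
    rw [← intervalIntegral.integral_add (klrc_intervalIntegrable_div hca2 hu (by nlinarith))
      (klrc_intervalIntegrable_div hcb2 hu (by nlinarith))]
    have heq : EqOn (fun s => a s ^ 2 / s + (1 - a s) ^ 2 / s) (fun s => (a s ^ 2 + (1 - a s) ^ 2) / s) (uIcc (Λ ^ 2 / 4) (Λ ^ 2)) :=
      fun s _ => by simp only; ring
    rw [intervalIntegral.integral_congr heq]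
    have hcont : ContinuousOn (fun s => a s ^ 2 + (1 - a s) ^ 2) (Icc (Λ ^ 2 / 4) (Λ ^ 2)) := (hca2.add hcb2).continuousOn
    refine (klrc_integral_div_le_mul_log hu (by nlinarith) hcont fun s _ =>
      klrc_sq_add_one_sub_sq_le (klrc_chi_nonneg _) (klrc_chi_le_one _)).trans (le_of_eq ?_)
    rw [show Λ ^ 2 / (Λ ^ 2 / 4) = 4 by field_simp, one_mul]
  have hlog : Real.log 16 = Real.log 4 + Real.log 4 := by
    rw [show (16 : ℝ) = 4 * 4 by norm_num, Real.log_mul (by norm_num) (by norm_num)]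
  rw [h1, h2, h3, hlog]
  linarith

/-- Numerics: `log 16 ≤ 14/5`. -/
theorem klrc_log_sixteen_le : Real.log 16 ≤ 14 / 5 := by
  have h : Real.log 16 = 4 * Real.log 2 := by
    rw [show (16 : ℝ) = 2 ^ 4 by norm_num, Real.log_pow]; norm_num
  rw [h]
  have := Real.log_two_lt_d9
  linarith

/-- **The sharp same-slice mass at scale `n ≥ 1`** in the carrier's spelling: `∫_{s>0} (χ₂(s/Λ_n²) − χ₂(s/Λ_{n−1}²))² ds/s ≤ log 16`. -/
theorem klrc_step_sameSlice_mass_le_sharp {n : ℕ} (hn : 1 ≤ n) :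
    ∫ s in Ioi 0, (salmhoferCutoff (s / klScale klE0 n ^ 2) - salmhoferCutoff (s / klScale klE0 (n - 1) ^ 2)) ^ 2 / s ≤
      Real.log 16 := by
  have hΛ := klth_klScale_pos n
  have hpred : klScale klE0 (n - 1) = 4 * klScale klE0 n := by
    obtain ⟨m, rfl⟩ : ∃ m, n = m + 1 := ⟨n - 1, by omega⟩
    rw [Nat.add_sub_cancel, klth_klScale_succ]; ring
  rw [hpred]
  exact klrc_sameSlice_mass_le_sharp hΛ

end Summit.HubbardSuperconductivity.HubbardSuperconductivity.Theorems.KLRegimeSplit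

end
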